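import Summits.QuantumFields.YangMills.Theorems.BalabanUVNodesN15TwoSpacingGluingCutRowsMargin
import HarnessLib

/-!
# THE GLUING STEP AT TWO LATTICE SPACINGS, XXIX: η-DEFECTS OF THE REMAINDER ROW FROM CUT DATA — the cut edition of FILE 46 §3 (local part), the Leibniz row of the split nonlocal term
# `N′∘M_h∘(M_χ∘N)`, and the assembly of `𝔇([Δ′_a, M_{h′}]N′_□, [Δ_a, M_h]N_□)` modulo ONE displayed row — the η-defect of the output-cut convolution `M_h∘N′∘N_□` (dag-n15-a's images
# machinery, asked on the bus) (dag-n15-c g12, FILE 71; generic)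

Cell `pub-ymgap`, seat `pub-ymgap-dag-n15-c` (R134 (a); HUMAN RULING D-0062), generation 12.  `bears_on: R4∕N15 · K3⁷ SpineGivenEndpointR13SepCoPH (stmt-QuantumFields-20544)`.
Filed `--supports stmt-QuantumFields-20544 --as helper` — COUNT-NEUTRAL.  Theorems only (0 `def`, 0 `sorry`).  Imports BY NAME FILE 68 `…TwoSpacingGluingCutRowsMargin` (through it 43–63);
nothing in the tree is modified.

WHY.  FILE 63 `hasMaj_idef_glued_of_cutRows` consumes, per cube, the η-defect `𝔇([Δ′_a, M_{h′}]G′(□), [Δ_a, M_h]G(□)) ≤ 1_□1_□·r·e^{−δd}` of the remainder row (`hDK`); unlike the one-grid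
letter `θ₀` (FILES 68∕69), `r` need NOT be small — it must carry the RATE.  So the defect is assembled from the N-IIj-type split (no margin, no commutator cancellation needed), every term a
CUT object or a torus operator: with `M_h∘M_χ = M_h`,
  `[Δ_loc + N′, M_h]∘N = [Δ_loc, M_h]∘N + N′∘M_h∘(M_χ∘N) − M_h∘N′∘N` (★ `commOp_comp_eq_split_cut`),
and `[Δ_loc, M_h]∘N = Σ_μ(M_{∇*∇h}(M_χN) − M_{∇h}(M_χ∇N) − M_{∇⁻h}(M_χ∇⁻N))` behind the coefficients' cuts (FILE 63's insertion).
* §1 ★★ `hasMaj_idef_commOp_lapOp_comp_of_cut` — FILE 46 `hasMaj_idef_commOp_lapOp_comp` with CUT rows and CUT defects at both spacings (dag-n15-a N-IIc∕N-IIe∕N-IIh shapes) and the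
  coefficient supports at both spacings: `≤ 1_S1_S·(|J|(c₂m₀ + o₂β + 2(c₁m₁ + o₁β₁)) + r_W)·e^{−δd}`.
* §2 ★ `commOp_comp_eq_split_cut`; ★★ `hasMaj_idef_nonlocal_cut` — `𝔇(N′′∘M_{h′}∘(M_{χ′}N′), N′∘M_h∘(M_χN)) ≤ 1_S(y′)·(c_N(m + oβ)c_r + r_B)·e^{−ρd}` (Leibniz; `N′ ≤ c_Ne^{−ρ₁d}` fine,
  fit `o`, cut row `β`, cut defect `m`, and the COMPOSITE defect row `𝔇(N′′,N′)∘(M_h(M_χN)) ≤ 1_S(y′)r_Be^{−ρd}` — composite because `Q*Q`'s two-grid defect exists only on differentiable inputs).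
* §3 ★★ `hasMaj_idef_commOp_comp_of_add_cut` — the three defects add up to FILE 63's `hDK`: `≤ 1_S(y′)·(r_loc + r_nl + r₃)·e^{−ρd}`, `r₃` = the DISPLAYED defect letter of `M_h∘N′∘N_□`.

HONEST FRAMING ∕ LIMITS.  Operator algebra + block-majorant bookkeeping ([B6] (2.92) p.239, (2.134) p.247; [B9] Thm 3.14 pp.426–427 = SHAPES ∕ MECHANISM ∕ difference template); nothing of
[B5]∕[B6]∕[B9] asserted.  NE2⁺ NOT PRINTED, NOT proved; N15 NOT discharged; counts of record UNMOVED (typed 28∕28 · discharged 5∕27); one finite 𝕋⁴ at fixed ε — NOT infinite volume, NOT OS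
on ℝ⁴, NOT a mass gap, NOT Clay; R4 closes the conditional finite-𝕋⁴ rung `BalabanLadder.UV` only.  Restate-immune (no Theses import).
-/

noncomputable section

namespace Summit.QuantumFields.YangMills.BalabanUVNodes.N15.Gluing

open Literature.MathematicalPhysics.QuantumFieldTheory.Balaban1983to89
open Literature.MathematicalPhysics.QuantumFieldTheory.Balaban1983to89.B11SectG (BlockNorm HasMaj RowSum hasMaj_comp)
open Literature.MathematicalPhysics.QuantumFieldTheory.Balaban1983to89.T4EtaRateDefect (idef idef_apply idef_comp idef_sub idef_add)
open Literature.MathematicalPhysics.QuantumFieldTheory.Balaban1983to89.T4EtaRateCoeffDefect (pull pull_apply diagK diagK_nonneg hasMaj_mulOp hasMaj_idef_mulOp)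
open Literature.MathematicalPhysics.QuantumFieldTheory.Balaban1983to89.B6RandomWalk (Triangle254)
open Literature.MathematicalPhysics.QuantumFieldTheory.Balaban1983to89.B6Prop26Gluing (mulOp mulOp_apply ind ind_nonneg ind_le_one)
open Summit.QuantumFields.YangMills.BalabanUVNodes.N15.BackgroundLayer (fgrad fgradAdj bgrad)

/-! ## §1 The local part's defect from cut rows and cut defects -/

section Local

variable {X X' : Type} [Fintype X] [Fintype X'] {J : Type} [Fintype J] {g : B6.Geometry} (blk : X → g.Site) (π : X' → X)

/-- ★★ **THE η-DEFECT OF THE (2.134) PIECE FROM CUT ROWS AND CUT DEFECTS** — FILE 46 `hasMaj_idef_commOp_lapOp_comp` for an unlocalized `N` whose letters and two-grid defects are given for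
the CUT objects `M_χN`, `M_χ∇N`, `M_χ∇⁻N` (both spacings), the partition's coefficients being supported in `{χ = 1}` at both spacings.
[cite: Balaban1984PropagatorsII, (2.133)–(2.134) p.247 (shapes); Balaban1985BackgroundPropagators, Thm 3.14 pp.426–427 (difference template)] -/
theorem hasMaj_idef_commOp_lapOp_comp_of_cut {n n' : ℝ} {e : J → X ≃ X} {e' : J → X' ≃ X'} {W N : (X → ℝ) →ₗ[ℝ] (X → ℝ)} {W' N' : (X' → ℝ) →ₗ[ℝ] (X' → ℝ)} {h χ : X → ℝ}
    {h' χ' : X' → ℝ} {S : Set g.Site} {β β₁ c₁ c₂ o₁ o₂ m₀ m₁ rW δ : ℝ} (hc₁ : 0 ≤ c₁) (hc₂ : 0 ≤ c₂) (ho₁ : 0 ≤ o₁) (ho₂ : 0 ≤ o₂)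
    (hh1 : ∀ μ x', |fgrad n' (e' μ) h' x'| ≤ c₁) (hh1b : ∀ μ x', |bgrad n' (e' μ) h' x'| ≤ c₁) (hh2 : ∀ μ x', |fgradAdj n' (e' μ) (fgrad n' (e' μ) h') x'| ≤ c₂)
    (hf1 : ∀ μ x', |fgrad n' (e' μ) h' x' - fgrad n (e μ) h (π x')| ≤ o₁) (hf1b : ∀ μ x', |bgrad n' (e' μ) h' x' - bgrad n (e μ) h (π x')| ≤ o₁)
    (hf2 : ∀ μ x', |fgradAdj n' (e' μ) (fgrad n' (e' μ) h') x' - fgradAdj n (e μ) (fgrad n (e μ) h) (π x')| ≤ o₂)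
    (hs2 : ∀ μ, mulOp (fgradAdj n (e μ) (fgrad n (e μ) h)) ∘ₗ mulOp χ = mulOp (fgradAdj n (e μ) (fgrad n (e μ) h)))
    (hs1 : ∀ μ, mulOp (fgrad n (e μ) h) ∘ₗ mulOp χ = mulOp (fgrad n (e μ) h)) (hs1b : ∀ μ, mulOp (bgrad n (e μ) h) ∘ₗ mulOp χ = mulOp (bgrad n (e μ) h))
    (hs2' : ∀ μ, mulOp (fgradAdj n' (e' μ) (fgrad n' (e' μ) h')) ∘ₗ mulOp χ' = mulOp (fgradAdj n' (e' μ) (fgrad n' (e' μ) h')))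
    (hs1' : ∀ μ, mulOp (fgrad n' (e' μ) h') ∘ₗ mulOp χ' = mulOp (fgrad n' (e' μ) h')) (hs1b' : ∀ μ, mulOp (bgrad n' (e' μ) h') ∘ₗ mulOp χ' = mulOp (bgrad n' (e' μ) h'))
    (hGc : HasMaj (BlockNorm.ofBlocks g blk) (BlockNorm.ofBlocks g blk) (mulOp χ ∘ₗ N) (fun y y' => ind S y * ind S y' * (β * Real.exp (-(δ * g.dist y y')))))
    (hDc : ∀ μ, HasMaj (BlockNorm.ofBlocks g blk) (BlockNorm.ofBlocks g blk) (mulOp χ ∘ₗ (fgrad n (e μ) ∘ₗ N)) (fun y y' => ind S y * ind S y' * (β₁ * Real.exp (-(δ * g.dist y y')))))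
    (hDbc : ∀ μ, HasMaj (BlockNorm.ofBlocks g blk) (BlockNorm.ofBlocks g blk) (mulOp χ ∘ₗ (bgrad n (e μ) ∘ₗ N)) (fun y y' => ind S y * ind S y' * (β₁ * Real.exp (-(δ * g.dist y y')))))
    (hIGc : HasMaj (BlockNorm.ofBlocks g blk) (BlockNorm.ofBlocks g (blk ∘ π)) (idef (pull π) (pull π) (mulOp χ' ∘ₗ N') (mulOp χ ∘ₗ N))
      (fun y y' => ind S y * ind S y' * (m₀ * Real.exp (-(δ * g.dist y y')))))
    (hIDc : ∀ μ, HasMaj (BlockNorm.ofBlocks g blk) (BlockNorm.ofBlocks g (blk ∘ π)) (idef (pull π) (pull π) (mulOp χ' ∘ₗ (fgrad n' (e' μ) ∘ₗ N')) (mulOp χ ∘ₗ (fgrad n (e μ) ∘ₗ N)))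
      (fun y y' => ind S y * ind S y' * (m₁ * Real.exp (-(δ * g.dist y y')))))
    (hIDbc : ∀ μ, HasMaj (BlockNorm.ofBlocks g blk) (BlockNorm.ofBlocks g (blk ∘ π)) (idef (pull π) (pull π) (mulOp χ' ∘ₗ (bgrad n' (e' μ) ∘ₗ N')) (mulOp χ ∘ₗ (bgrad n (e μ) ∘ₗ N)))
      (fun y y' => ind S y * ind S y' * (m₁ * Real.exp (-(δ * g.dist y y')))))
    (hDW : HasMaj (BlockNorm.ofBlocks g blk) (BlockNorm.ofBlocks g (blk ∘ π)) (idef (pull π) (pull π) (commOp W' h' ∘ₗ N') (commOp W h ∘ₗ N))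
      (fun y y' => ind S y * ind S y' * (rW * Real.exp (-(δ * g.dist y y'))))) :
    HasMaj (BlockNorm.ofBlocks g blk) (BlockNorm.ofBlocks g (blk ∘ π)) (idef (pull π) (pull π) (commOp (lapOp n' e' W') h' ∘ₗ N') (commOp (lapOp n e W) h ∘ₗ N))
      (fun y y' => ind S y * ind S y' * ((Fintype.card J * (c₂ * m₀ + o₂ * β + 2 * (c₁ * m₁ + o₁ * β₁)) + rW) * Real.exp (-(δ * g.dist y y')))) := by
  have ins : ∀ {Y : Type} (a c : Y → ℝ) (T : (Y → ℝ) →ₗ[ℝ] (Y → ℝ)), mulOp a ∘ₗ mulOp c = mulOp a → mulOp a ∘ₗ T = mulOp a ∘ₗ (mulOp c ∘ₗ T) := fun a c T ha => by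
    rw [← LinearMap.comp_assoc, ha]
  have hterm : ∀ μ, HasMaj (BlockNorm.ofBlocks g blk) (BlockNorm.ofBlocks g (blk ∘ π))
      (idef (pull π) (pull π)
        (mulOp (fgradAdj n' (e' μ) (fgrad n' (e' μ) h')) ∘ₗ N' - mulOp (fgrad n' (e' μ) h') ∘ₗ (fgrad n' (e' μ) ∘ₗ N') - mulOp (bgrad n' (e' μ) h') ∘ₗ (bgrad n' (e' μ) ∘ₗ N'))
        (mulOp (fgradAdj n (e μ) (fgrad n (e μ) h)) ∘ₗ N - mulOp (fgrad n (e μ) h) ∘ₗ (fgrad n (e μ) ∘ₗ N) - mulOp (bgrad n (e μ) h) ∘ₗ (bgrad n (e μ) ∘ₗ N)))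
      (fun y y' => ind S y * ind S y' * ((c₂ * m₀ + o₂ * β + 2 * (c₁ * m₁ + o₁ * β₁)) * Real.exp (-(δ * g.dist y y')))) := fun μ => by
    rw [ins _ _ N (hs2 μ), ins _ _ (fgrad n (e μ) ∘ₗ N) (hs1 μ), ins _ _ (bgrad n (e μ) ∘ₗ N) (hs1b μ), ins _ _ N' (hs2' μ), ins _ _ (fgrad n' (e' μ) ∘ₗ N') (hs1' μ),
      ins _ _ (bgrad n' (e' μ) ∘ₗ N') (hs1b' μ)]
    have t0 := hasMaj_idef_mulOp_comp_loc blk π hc₂ ho₂ (hh2 μ) (hf2 μ) hGc hIGc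
    have t1 := hasMaj_idef_mulOp_comp_loc blk π hc₁ ho₁ (hh1 μ) (hf1 μ) (hDc μ) (hIDc μ)
    have t2 := hasMaj_idef_mulOp_comp_loc blk π hc₁ ho₁ (hh1b μ) (hf1b μ) (hDbc μ) (hIDbc μ)
    rw [idef_sub, idef_sub]
    refine ((t0.sub t1).sub t2).mono fun y y' => le_of_eq ?_
    ring
  have hsum := hasMaj_fsum (b₁ := BlockNorm.ofBlocks g blk) (b₃ := BlockNorm.ofBlocks g (blk ∘ π)) Finset.univ _ _ fun μ _ => hterm μ
  rw [commOp_lapOp_comp, commOp_lapOp_comp, idef_add, idef_fsum]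
  refine (hsum.add hDW).mono fun y y' => le_of_eq ?_
  simp only [Finset.sum_const, Finset.card_univ, nsmul_eq_mul]
  ring

end Local

/-! ## §2 The split nonlocal term and its defect -/

section Nonlocal

variable {X X' : Type} [Fintype X] [Fintype X'] {g : B6.Geometry} (blk : X → g.Site) (π : X' → X) {σ cr : ℝ}

omit [Fintype X] in
/-- ★ **THE SPLIT FOR THE DEFECT** (no margin): `M_h∘M_χ = M_h` ⟹ `[Δ_loc + N′, M_h]∘N = [Δ_loc, M_h]∘N + (N′∘M_h∘(M_χ∘N) − M_h∘(N′∘N))`. [cite: Balaban1984PropagatorsII, (2.92) p.239 (shape)] -/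
theorem commOp_comp_eq_split_cut {Δloc N' N : (X → ℝ) →ₗ[ℝ] (X → ℝ)} {h χ : X → ℝ} (hcut : mulOp h ∘ₗ mulOp χ = mulOp h) :
    commOp (Δloc + N') h ∘ₗ N = commOp Δloc h ∘ₗ N + ((N' ∘ₗ mulOp h) ∘ₗ (mulOp χ ∘ₗ N) - mulOp h ∘ₗ (N' ∘ₗ N)) := by
  rw [commOp_add_left, LinearMap.add_comp]
  congr 1
  rw [commOp, LinearMap.sub_comp, LinearMap.comp_assoc, LinearMap.comp_assoc, LinearMap.comp_assoc, ← LinearMap.comp_assoc N (mulOp χ) (mulOp h), hcut]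

/-- ★★ **THE η-DEFECT OF `N′∘M_h∘(M_χN)`** by Leibniz: `N′ ≤ c_Ne^{−ρ₁d}` (fine), `|h′| ≤ 1`, fit `|h′ − h∘π| ≤ o`, cut row `M_χN ≤ 1_S1_Sβe^{−δd}` (coarse), cut defect
`𝔇(M_{χ′}N′, M_χN) ≤ 1_S1_Sme^{−δd}`, and the COMPOSITE defect row `𝔇(N′′, N′)∘(M_h∘(M_χN)) ≤ 1_S(y′)·r_B·e^{−ρd}` (displayed as a composite because the block-averaging part `Q*Q` of `N′`
has a two-grid defect only on differentiable inputs — dag-n15-a part 43 `hasMaj_qvRe_pull_sub_comp`) ⟹ `≤ 1_S(y′)·(c_N(m + oβ)c_r + r_B)·e^{−ρd}` (`0 ≤ ρ ≤ δ`, `ρ + σ ≤ ρ₁`).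
[cite: Balaban1985BackgroundPropagators, Thm 3.14 pp.426–427 (difference template)] -/
theorem hasMaj_idef_nonlocal_cut (htri : Triangle254 g) (hd : ∀ a b : g.Site, 0 ≤ g.dist a b) (hrow : RowSum g σ cr)
    {NL N : (X → ℝ) →ₗ[ℝ] (X → ℝ)} {NL' N' : (X' → ℝ) →ₗ[ℝ] (X' → ℝ)} {h χ : X → ℝ} {h' χ' : X' → ℝ} {S : Set g.Site} {cN rB o β m δ ρ ρ₁ : ℝ}
    (hcN : 0 ≤ cN) (ho : 0 ≤ o) (hβ : 0 ≤ β) (hm : 0 ≤ m) (hρ : 0 ≤ ρ) (hρδ : ρ ≤ δ) (hρ₁ : ρ + σ ≤ ρ₁)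
    (hh' : ∀ x', |h' x'| ≤ 1) (hfit : ∀ x', |h' x' - h (π x')| ≤ o)
    (hNL' : HasMaj (BlockNorm.ofBlocks g (blk ∘ π)) (BlockNorm.ofBlocks g (blk ∘ π)) NL' (fun y y' => cN * Real.exp (-(ρ₁ * g.dist y y'))))
    (hGc : HasMaj (BlockNorm.ofBlocks g blk) (BlockNorm.ofBlocks g blk) (mulOp χ ∘ₗ N) (fun y y' => ind S y * ind S y' * (β * Real.exp (-(δ * g.dist y y')))))
    (hIGc : HasMaj (BlockNorm.ofBlocks g blk) (BlockNorm.ofBlocks g (blk ∘ π)) (idef (pull π) (pull π) (mulOp χ' ∘ₗ N') (mulOp χ ∘ₗ N))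
      (fun y y' => ind S y * ind S y' * (m * Real.exp (-(δ * g.dist y y')))))
    (hT3 : HasMaj (BlockNorm.ofBlocks g blk) (BlockNorm.ofBlocks g (blk ∘ π)) (idef (pull π) (pull π) NL' NL ∘ₗ (mulOp h ∘ₗ (mulOp χ ∘ₗ N)))
      (fun y y' => ind S y' * (rB * Real.exp (-(ρ * g.dist y y'))))) :
    HasMaj (BlockNorm.ofBlocks g blk) (BlockNorm.ofBlocks g (blk ∘ π))
      (idef (pull π) (pull π) ((NL' ∘ₗ mulOp h') ∘ₗ (mulOp χ' ∘ₗ N')) ((NL ∘ₗ mulOp h) ∘ₗ (mulOp χ ∘ₗ N)))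
      (fun y y' => ind S y' * ((cN * (m + o * β) * cr + rB) * Real.exp (-(ρ * g.dist y y')))) := by
  -- `𝔇(A′B′, AB) = A′∘𝔇(B′, B) + 𝔇(A′, A)∘B` with `A = N_L∘M_h`, `B = M_χN`; and `𝔇(N_L′M_{h′}, N_LM_h) = N_L′∘𝔇(M_{h′}, M_h) + 𝔇(N_L′, N_L)∘M_h`
  have hMh' := hasMaj_mulOp (g := g) (blk ∘ π) (a := h') (m := fun _ => (1 : ℝ)) (fun _ => zero_le_one) hh'
  have hDM := hasMaj_idef_mulOp (g := g) blk π (a' := h') (a := h) (o := fun _ => o) (fun _ => ho) hfit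
  -- T1 = N_L′ ∘ (M_{h′} ∘ 𝔇(B′, B))
  have i1 := hasMaj_diag_comp (blk ∘ π) (fun _ => zero_le_one) hMh' hIGc
  have t1 := hasMaj_comp_exp_in (blk ∘ π) htri hd hrow hcN (by positivity : (0 : ℝ) ≤ 1 * m) hρ hρδ hρ₁ hNL' (i1.mono fun y y' => le_of_eq (by ring))
  -- T2 = N_L′ ∘ (𝔇(M_{h′}, M_h) ∘ B)
  have i2 := hasMaj_diag_comp blk (fun _ => ho) hDM hGc
  have t2 := hasMaj_comp_exp_in (blk ∘ π) htri hd hrow hcN (by positivity : (0 : ℝ) ≤ o * β) hρ hρδ hρ₁ hNL' (i2.mono fun y y' => le_of_eq (by ring))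
  have hop : idef (pull π) (pull π) ((NL' ∘ₗ mulOp h') ∘ₗ (mulOp χ' ∘ₗ N')) ((NL ∘ₗ mulOp h) ∘ₗ (mulOp χ ∘ₗ N)) =
      NL' ∘ₗ (mulOp h' ∘ₗ idef (pull π) (pull π) (mulOp χ' ∘ₗ N') (mulOp χ ∘ₗ N)) +
        (NL' ∘ₗ (idef (pull π) (pull π) (mulOp h') (mulOp h) ∘ₗ (mulOp χ ∘ₗ N)) + idef (pull π) (pull π) NL' NL ∘ₗ (mulOp h ∘ₗ (mulOp χ ∘ₗ N))) := by
    rw [idef_comp (pull π) (pull π) (pull π) (NL' ∘ₗ mulOp h') (mulOp χ' ∘ₗ N') (NL ∘ₗ mulOp h) (mulOp χ ∘ₗ N),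
      idef_comp (pull π) (pull π) (pull π) NL' (mulOp h') NL (mulOp h), LinearMap.add_comp, LinearMap.comp_assoc, LinearMap.comp_assoc, LinearMap.comp_assoc]
  rw [hop]
  refine (t1.add (t2.add hT3)).mono fun y y' => le_of_eq ?_
  ring

end Nonlocal

/-! ## §3 Assembly of the remainder row's defect -/

section Assembly

variable {X X' : Type} [Fintype X] [Fintype X'] {g : B6.Geometry} (blk : X → g.Site) (π : X' → X)

/-- ★★ **THE η-DEFECT OF THE REMAINDER ROW, ASSEMBLED**: the local part's defect `r_loc` (§1), the split nonlocal term's defect `r_nl` (§2) and the DISPLAYED defect `r₃` of the output-cut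
convolution `M_h∘(N′∘N_□)` (dag-n15-a's images machinery: the η-defect analogue of N-IIi `hasMaj_chiCube_comp_neumannCubeG` with `T₁ := M_h∘N′`) ⟹ FILE 63's `hDK`:
`𝔇([Δ′_loc + N′′, M_{h′}]N′, [Δ_loc + N′, M_h]N) ≤ 1_S(y′)·(r_loc + r_nl + r₃)·e^{−ρd}` (`0 ≤ ρ ≤ δ`). [cite: Balaban1985BackgroundPropagators, Thm 3.14 pp.426–427 (difference template)] -/
theorem hasMaj_idef_commOp_comp_of_add_cut (hd : ∀ a b : g.Site, 0 ≤ g.dist a b) {Δloc NL N : (X → ℝ) →ₗ[ℝ] (X → ℝ)} {Δloc' NL' N' : (X' → ℝ) →ₗ[ℝ] (X' → ℝ)}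
    {h χ : X → ℝ} {h' χ' : X' → ℝ} {S : Set g.Site} {rloc rnl r₃ δ ρ : ℝ} (hrloc : 0 ≤ rloc) (hr₃ : 0 ≤ r₃) (hρδ : ρ ≤ δ)
    (hcut : mulOp h ∘ₗ mulOp χ = mulOp h) (hcut' : mulOp h' ∘ₗ mulOp χ' = mulOp h')
    (hDloc : HasMaj (BlockNorm.ofBlocks g blk) (BlockNorm.ofBlocks g (blk ∘ π)) (idef (pull π) (pull π) (commOp Δloc' h' ∘ₗ N') (commOp Δloc h ∘ₗ N))
      (fun y y' => ind S y * ind S y' * (rloc * Real.exp (-(δ * g.dist y y')))))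
    (hDnl : HasMaj (BlockNorm.ofBlocks g blk) (BlockNorm.ofBlocks g (blk ∘ π))
      (idef (pull π) (pull π) ((NL' ∘ₗ mulOp h') ∘ₗ (mulOp χ' ∘ₗ N')) ((NL ∘ₗ mulOp h) ∘ₗ (mulOp χ ∘ₗ N))) (fun y y' => ind S y' * (rnl * Real.exp (-(ρ * g.dist y y')))))
    (hD3 : HasMaj (BlockNorm.ofBlocks g blk) (BlockNorm.ofBlocks g (blk ∘ π)) (idef (pull π) (pull π) (mulOp h' ∘ₗ (NL' ∘ₗ N')) (mulOp h ∘ₗ (NL ∘ₗ N)))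
      (fun y y' => ind S y * ind S y' * (r₃ * Real.exp (-(δ * g.dist y y'))))) :
    HasMaj (BlockNorm.ofBlocks g blk) (BlockNorm.ofBlocks g (blk ∘ π))
      (idef (pull π) (pull π) (commOp (Δloc' + NL') h' ∘ₗ N') (commOp (Δloc + NL) h ∘ₗ N))
      (fun y y' => ind S y' * ((rloc + rnl + r₃) * Real.exp (-(ρ * g.dist y y')))) := by
  rw [commOp_comp_eq_split_cut hcut, commOp_comp_eq_split_cut hcut', idef_add, idef_sub]
  refine (hDloc.add (hDnl.sub hD3)).mono fun y y' => ?_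
  have hexp : Real.exp (-(δ * g.dist y y')) ≤ Real.exp (-(ρ * g.dist y y')) := Real.exp_le_exp.2 (by nlinarith [hd y y'])
  have hiy : ind S y ≤ 1 := ind_le_one S y
  have hiy0 : 0 ≤ ind S y := ind_nonneg S y
  have hiy'0 : 0 ≤ ind S y' := ind_nonneg S y'
  have hE0 : 0 ≤ Real.exp (-(ρ * g.dist y y')) := Real.exp_nonneg _
  have two_sided : ∀ θ : ℝ, 0 ≤ θ → ind S y * ind S y' * (θ * Real.exp (-(δ * g.dist y y'))) ≤ ind S y' * (θ * Real.exp (-(ρ * g.dist y y'))) := fun θ hθ => by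
    calc ind S y * ind S y' * (θ * Real.exp (-(δ * g.dist y y'))) ≤ ind S y * ind S y' * (θ * Real.exp (-(ρ * g.dist y y'))) :=
          mul_le_mul_of_nonneg_left (mul_le_mul_of_nonneg_left hexp hθ) (mul_nonneg hiy0 hiy'0)
      _ ≤ 1 * ind S y' * (θ * Real.exp (-(ρ * g.dist y y'))) := mul_le_mul_of_nonneg_right (mul_le_mul_of_nonneg_right hiy hiy'0) (mul_nonneg hθ hE0)
      _ = _ := by ring
  have h1 := two_sided rloc hrloc
  have h3 := two_sided r₃ hr₃
  calc ind S y * ind S y' * (rloc * Real.exp (-(δ * g.dist y y'))) + (ind S y' * (rnl * Real.exp (-(ρ * g.dist y y'))) + ind S y * ind S y' * (r₃ * Real.exp (-(δ * g.dist y y'))))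
      ≤ ind S y' * (rloc * Real.exp (-(ρ * g.dist y y'))) + (ind S y' * (rnl * Real.exp (-(ρ * g.dist y y'))) + ind S y' * (r₃ * Real.exp (-(ρ * g.dist y y')))) := by linarith
    _ = _ := by ring

end Assembly

end Summit.QuantumFields.YangMills.BalabanUVNodes.N15.Gluing

end
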